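import Mathlib
import Summits.CriticalPhenomena.SAWScalingLimit.Statement
import Literature.Probability.RandomPlanarGeometry.DiagonalDressedSAW
import HarnessLib

/-!
# Birth skeleton (BC3) of piece `ScoreDecoupling` of the split of `DiagonalUniversality`
(route `SAWDeterminantalDiagonal`, crux stmt-CriticalPhenomena-8247; crux-strategist BC2 redirect)

`ScoreDecoupling` is one of the three children CriticalCurve / WindowRigidity / ScoreDecoupling (statements in
`Cruxes/DiagonalUniversality/Split/SPLIT.md`; objects in
`Literature/Probability/RandomPlanarGeometry/DiagonalDressedSAW.lean`). Until the route split is applied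
the piece is a LOCAL def here with the child's statement verbatim; afterwards replace `ScoreDecoupling` below by the
route decl `Summit.CriticalPhenomena.SAWScalingLimit.Theses.SAWDeterminantalDiagonal.ScoreDecoupling` (same term).
Two named stubs (`sorry`, genuine lemmas of the line) and the kernel-checked composition `ScoreDecoupling_of`.
Checked: lean check rc 0, sorries = 2 = stubs; per-stub probes stub → ScoreDecoupling and stub → SAWScalingLimit
FAIL (bc/PROBES.md in the strategist folder, reproduced in SPLIT.md).
-/

noncomputable section

namespace Summit.CriticalPhenomena.SAWScalingLimit.Cruxes.DiagonalUniversality.Birth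

open MeasureTheory Filter Topology Set
open scoped NNReal ENNReal BoundedContinuousFunction
open Literature.Probability.RandomPlanarGeometry Literature.Probability.LatticeModels

namespace ScoreDecouplingBirth

/-- The child `ScoreDecoupling` of the split of `DiagonalUniversality` (verbatim statement of the route item to be). -/
def ScoreDecoupling : Prop :=
  ∀ ξ : ℝ → ℝ, Literature.Probability.RandomPlanarGeometry.SAW.IsDiagonalCriticalCurve ξ → ∀ (D : Literature.Probability.RandomPlanarGeometry.DobrushinDomain) (a b : ℝ → Literature.Probability.LatticeModels.Site 2), Literature.Probability.RandomPlanarGeometry.SAW.IsEndpointApprox D a b → ∀ f : BoundedContinuousFunction (Literature.Probability.RandomPlanarGeometry.CurveClass ℂ) ℝ, Filter.Tendsto (fun δ => ∫ s in (0 : ℝ)..(1 / 2), |ProbabilityTheory.covariance (fun γ : Literature.Probability.RandomPlanarGeometry.SAW.DomainSAW D.carrier δ (a δ) (b δ) => f γ.curve) (Literature.Probability.RandomPlanarGeometry.SAW.diagonalScore ξ s) (Literature.Probability.RandomPlanarGeometry.SAW.diagonalLaw D.carrier δ (a δ) (b δ) s (ξ s))|) (nhdsWithin 0 (Set.Ioi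 0)) (nhds 0)

/-! ## Birth skeleton of piece `ScoreDecoupling`
(= along every critical curve, `∫₀^{1/2} |Cov_{s,δ}(f ∘ curve, score_s)| ds → 0` as `δ → 0⁺`)

Two stubs: POINTWISE decoupling at each fixed dressing parameter `s ∈ [0, 1/2]` (irrelevance of
the neutral score for the critical `s`-model), and ASYMPTOTIC EQUICONTINUITY of
`s ↦ Cov_{s,δ}` on `[0, 1/2]` uniformly in small `δ` (regularity of the critical family in the
dressing parameter: the `s`-derivative of the covariance is a third cumulant of the score). The
composition is the real-analysis step pointwise + equicontinuous on a compact interval ⇒ uniform ⇒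
the `L¹(ds)`-norm tends to `0` (finite `η`-net, no measurability needed). -/

/-- Stub 1 — **pointwise score decoupling**: for each fixed `s ∈ [0, 1/2]` the covariance of a
bounded continuous functional of the curve with the score, under the critical `s`-model, tends to
`0` as `δ → 0⁺`. -/
theorem stub_pointwise_decoupling :
    ∀ ξ : ℝ → ℝ, SAW.IsDiagonalCriticalCurve ξ →
      ∀ (D : DobrushinDomain) (a b : ℝ → Site 2), SAW.IsEndpointApprox D a b →
        ∀ f : CurveClass ℂ →ᵇ ℝ, ∀ s ∈ Set.Icc (0 : ℝ) (1 / 2),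
          Tendsto (fun δ => ProbabilityTheory.covariance (fun γ => f γ.curve)
            (SAW.diagonalScore ξ s) (SAW.diagonalLaw D.carrier δ (a δ) (b δ) s (ξ s)))
            (𝓝[>] (0 : ℝ)) (𝓝 0) := by
  sorry

/-- Stub 2 — **asymptotic equicontinuity of the score covariance in the dressing parameter**,
uniformly in small mesh: for every `ε > 0` there is `η > 0` such that eventually (as `δ → 0⁺`)
`|Cov_{s,δ} − Cov_{t,δ}| ≤ ε` whenever `s, t ∈ [0, 1/2]`, `|s − t| ≤ η`. -/
theorem stub_asymptotic_equicontinuity :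
    ∀ ξ : ℝ → ℝ, SAW.IsDiagonalCriticalCurve ξ →
      ∀ (D : DobrushinDomain) (a b : ℝ → Site 2), SAW.IsEndpointApprox D a b →
        ∀ f : CurveClass ℂ →ᵇ ℝ, ∀ ε : ℝ, 0 < ε → ∃ η : ℝ, 0 < η ∧
          ∀ᶠ δ in 𝓝[>] (0 : ℝ), ∀ s ∈ Set.Icc (0 : ℝ) (1 / 2), ∀ t ∈ Set.Icc (0 : ℝ) (1 / 2),
            |s - t| ≤ η →
              |ProbabilityTheory.covariance (fun γ => f γ.curve) (SAW.diagonalScore ξ s)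
                  (SAW.diagonalLaw D.carrier δ (a δ) (b δ) s (ξ s)) -
                ProbabilityTheory.covariance (fun γ => f γ.curve) (SAW.diagonalScore ξ t)
                  (SAW.diagonalLaw D.carrier δ (a δ) (b δ) t (ξ t))| ≤ ε := by
  sorry

/-- Composition: pointwise decoupling + asymptotic equicontinuity on the compact interval
`[0, 1/2]` give uniform smallness (finite `η`-net `{kη}`), hence the `L¹(ds)` bound
`∫₀^{1/2} |Cov_{s,δ}| ds ≤ ε/2 < ε` eventually. -/
theorem ScoreDecoupling_of :
    (∀ ξ : ℝ → ℝ, SAW.IsDiagonalCriticalCurve ξ →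
      ∀ (D : DobrushinDomain) (a b : ℝ → Site 2), SAW.IsEndpointApprox D a b →
        ∀ f : CurveClass ℂ →ᵇ ℝ, ∀ s ∈ Set.Icc (0 : ℝ) (1 / 2),
          Tendsto (fun δ => ProbabilityTheory.covariance (fun γ => f γ.curve)
            (SAW.diagonalScore ξ s) (SAW.diagonalLaw D.carrier δ (a δ) (b δ) s (ξ s)))
            (𝓝[>] (0 : ℝ)) (𝓝 0)) →
    (∀ ξ : ℝ → ℝ, SAW.IsDiagonalCriticalCurve ξ →
      ∀ (D : DobrushinDomain) (a b : ℝ → Site 2), SAW.IsEndpointApprox D a b →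
        ∀ f : CurveClass ℂ →ᵇ ℝ, ∀ ε : ℝ, 0 < ε → ∃ η : ℝ, 0 < η ∧
          ∀ᶠ δ in 𝓝[>] (0 : ℝ), ∀ s ∈ Set.Icc (0 : ℝ) (1 / 2), ∀ t ∈ Set.Icc (0 : ℝ) (1 / 2),
            |s - t| ≤ η →
              |ProbabilityTheory.covariance (fun γ => f γ.curve) (SAW.diagonalScore ξ s)
                  (SAW.diagonalLaw D.carrier δ (a δ) (b δ) s (ξ s)) -
                ProbabilityTheory.covariance (fun γ => f γ.curve) (SAW.diagonalScore ξ t)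
                  (SAW.diagonalLaw D.carrier δ (a δ) (b δ) t (ξ t))| ≤ ε) →
    ScoreDecoupling := by
  intro h1 h2 ξ hξ D a b hab f
  -- the covariance as a function of mesh and dressing parameter
  set C : ℝ → ℝ → ℝ := fun δ s => ProbabilityTheory.covariance (fun γ => f γ.curve)
    (SAW.diagonalScore ξ s) (SAW.diagonalLaw D.carrier δ (a δ) (b δ) s (ξ s)) with hC
  rw [Metric.tendsto_nhds]
  intro ε hε
  obtain ⟨η, hη, hequi⟩ := h2 ξ hξ D a b hab f (ε / 2) (half_pos hε)
  -- the finite net {k η : k ≤ N}, N = ⌊(1/2)/η⌋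
  set N : ℕ := ⌊(1 / 2 : ℝ) / η⌋₊ with hN
  have hnet : ∀ k ∈ Finset.range (N + 1), ((k : ℝ) * η) ∈ Set.Icc (0 : ℝ) (1 / 2) := by
    intro k hk
    refine ⟨by positivity, ?_⟩
    have hk' : (k : ℝ) ≤ N := by exact_mod_cast Nat.lt_succ_iff.mp (Finset.mem_range.mp hk)
    calc (k : ℝ) * η ≤ N * η := by gcongr
      _ ≤ (1 / 2) / η * η := by gcongr; exact Nat.floor_le (by positivity)
      _ = 1 / 2 := by field_simp
  have hpt : ∀ᶠ δ in 𝓝[>] (0 : ℝ), ∀ k ∈ Finset.range (N + 1), |C δ (k * η)| < ε / 2 := by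
    refine (Filter.eventually_all_finset _).mpr fun k hk => ?_
    have h := h1 ξ hξ D a b hab f (k * η) (hnet k hk)
    rw [Metric.tendsto_nhds] at h
    filter_upwards [h (ε / 2) (half_pos hε)] with δ hδ
    simpa only [hC, Real.dist_eq, sub_zero] using hδ
  filter_upwards [hpt, hequi] with δ hp he
  -- uniform bound on [0, 1/2]
  have hunif : ∀ s ∈ Set.Icc (0 : ℝ) (1 / 2), |C δ s| ≤ ε := by
    intro s hs
    set k : ℕ := ⌊s / η⌋₊ with hk
    have hsη : 0 ≤ s / η := div_nonneg hs.1 hη.le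
    have hkmem : k ∈ Finset.range (N + 1) := by
      refine Finset.mem_range.mpr (Nat.lt_succ_of_le ?_)
      exact Nat.floor_le_floor (div_le_div_of_nonneg_right hs.2 hη.le)
    have ht : ((k : ℝ) * η) ∈ Set.Icc (0 : ℝ) (1 / 2) := hnet k hkmem
    have hle : (k : ℝ) * η ≤ s := by
      have := Nat.floor_le hsη
      calc (k : ℝ) * η ≤ s / η * η := by gcongr
        _ = s := by field_simp
    have hlt : s < ((k : ℝ) + 1) * η := by
      have := Nat.lt_floor_add_one (s / η)
      calc s = s / η * η := by field_simp
        _ < ((k : ℝ) + 1) * η := by gcongr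
    have hdist : |s - (k : ℝ) * η| ≤ η := by
      rw [abs_of_nonneg (by linarith)]
      nlinarith
    have h1' : |C δ s - C δ (k * η)| ≤ ε / 2 := he s hs _ ht hdist
    have h2' : |C δ (k * η)| < ε / 2 := hp k hkmem
    have := abs_sub_abs_le_abs_sub (C δ s) (C δ (k * η))
    linarith
  -- integrate the uniform bound over [0, 1/2]
  have hI : ‖∫ s in (0 : ℝ)..(1 / 2), |C δ s|‖ ≤ ε * |(1 / 2 : ℝ) - 0| := by
    refine intervalIntegral.norm_integral_le_of_norm_le_const fun s hs => ?_
    rw [Set.uIoc_of_le (by norm_num : (0 : ℝ) ≤ 1 / 2)] at hs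
    rw [Real.norm_eq_abs, abs_abs]
    exact hunif s ⟨hs.1.le, hs.2⟩
  rw [Real.dist_eq, sub_zero, ← Real.norm_eq_abs]
  calc ‖∫ s in (0 : ℝ)..(1 / 2), |C δ s|‖ ≤ ε * |(1 / 2 : ℝ) - 0| := hI
    _ = ε / 2 := by rw [sub_zero, abs_of_pos (by norm_num : (0 : ℝ) < 1 / 2)]; ring
    _ < ε := half_lt_self hε

end ScoreDecouplingBirth

end Summit.CriticalPhenomena.SAWScalingLimit.Cruxes.DiagonalUniversality.Birth
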